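import Summits.QuantumFields.BalabanUV.Beta.EriceRemainderEnclosureHistoryAutonomyComparisonNonlinearSplitPrep
import Summits.QuantumFields.BalabanUV.Beta.EriceRemainderEnclosureHistoryAutonomyComparisonNonlinearBaseDefect
import Summits.QuantumFields.BalabanUV.Beta.EriceRemainderEnclosureHistoryAutonomyComparisonNonlinearSize

/-!
# EriceRemainderEnclosureHistoryAutonomyComparisonNonlinearSplit — (E123b) **COMPARISON FOR EVERY SPLIT EXCESS `E = E₁ + E₂` (SMOOTH + SMALL) WITH `5·ME₁·γ + 10·sup E₂ ≤ β₀`.**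
# `B u = β₀ + Σ_{k<K} L_k·u_k` (`β₀ > 0`, `L ≥ 0`, `L_0 = 0`; profile, range `K`, sizes, loads ARBITRARY); functionals `B ≤ B₁ ≤ B′` on the box with `B₁ − B` isotone of
# modulus `ME₁` and `B′ − B₁` isotone, `≤ E₂`, of ANY steepness; `B′` with a modulus (family).  Then (**`le_of_split_excess`**, family-free) ANY box solutions `h`, `h′` of
# `B`, `B′` from one pin satisfy `h′ ≤ h` at every scale; (**`steps_nonneg_gauge_split`**) along every base orbit `X ≥ 0`, the gauge, and the variation bound for the total
# excess.  This UNITES (E119d) `le_of_small_modulus_excess` (`E₂ = 0`, up to the constant `β₀∕5`) and (E121e) `le_of_small_isotone_excess` (`E₁ = 0`): a smooth main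
# perturbation of any size plus a rough small correction.  Assembled from the generic pieces: defect (E123a) `conf_incr_ge_split` (`θ_k = F + ME₁h³∕2 + e₂h²`), price
# (E121b) `defect_size_le` at the size `ME₁γ∕2 + e₂ ≤ β₀∕10`, step (E121d) `gauge_step_of_defect`, base (E122a) `base_gauge_of_defect` + (E121b) `var_base`.

Cell `pub-balaban`, β-function sub-cell, BINDER row D4 «RemainderConst leaves for Bałaban's split» (`HOME/BINDER-OWNERS.md`; owner lineage `b2b-balaban-beta-an4`;
this file by co-owner #2 lineage `b2b-balaban-beta-d4-p2`, generation 99), β-FLOW TEAM duty (1), FREEZE (0) honoured (def-free; imports (E123a), (E122a), (E121e); uses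
(E118a) `affine_facts`, (E119b) `excess_facts` ∕ `cmp_of_steps_nonneg` ∕ `excess_orbit_antitone`, (E121b) `defect_size_le` ∕ `exists_base_depth_var` ∕ `var_base`, (E121d)
`gauge_step_of_defect`, (E122a) `base_gauge_of_defect`, (E123a) `conf_incr_ge_split`, (E49j) `effective_le_of_small_pin`, (E49k) `family_le_of_orbit`, (E39)
`exists_memFlow_zm`, (E43b) `memFlow_unique_of_monotone_zm`, (E48a) `family_mem` ∕ `family_zero` ∕ `le_of_pin_le` ∕ `strictAnti_of_memFlow` BY NAME; §2–§3 are (E121e)'s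
proofs re-run — nothing else restated).

HONEST FRAMING (page 1, verbatim and binding).  *"Discharging BetaPertH makes Bałaban's UV stability UNCONDITIONAL — a real constructive-QFT result; it is
NOT the continuum limit and NOT the Clay problem."*  THIS FILE DISCHARGES NOTHING OF THE KIND.  Elementary real analysis about ABSTRACT functionals on a box
]0,γ]^ℕ with displayed floors, moduli, profiles and signs — hypotheses of a census, not facts; the form, signs, ages and moments of Bałaban's (1.22) limit
functional are NOT PRINTED ([I] p. 298; GAPS G-t4-U2-1∕-2) and NOT asserted.  Row D4 class UNCHANGED (critical-path width 0; instance 0∕1; D4 DISCHARGE NO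
DATE).  HONEST DEPENDENCY: continuum YM on T⁴ ⇐ BetaPertH ∧ nine spine estimates (0/9 proved); BetaPertH ⇐ (D1) ∧ (D4) ∧ CAP+tail; G-an2-4 gates asym, D1
and NE2/3/4.  NOT CLAIMED: rough parts larger than `(β₀ − 5ME₁γ)∕10` on heavy rows, Markov weight, anything printed — NOT B12 Thm 2, NOT BetaPertH, NOT continuum,
NOT Clay.

WHAT IS PROVED ([folklore]; 0 `def`, 0 sorry).  §1 `split_facts`, `split_orbit_antitone`, **`gauge_step_split`**, **`base_gauge_split`**.  §2 **`steps_nonneg_gauge_split`**.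
§3 **`effective_le_split`**, **`le_of_split_excess`**.
-/

noncomputable section
open Finset Set

namespace Summit.QuantumFields.BalabanUV.Beta.EriceRemainderEnclosureHistoryAutonomyComparisonNonlinearSplit

open Literature.MathematicalPhysics.QuantumFieldTheory.Balaban1983to89
open Literature.MathematicalPhysics.QuantumFieldTheory.Balaban1983to89.T4BetaStationary
open Literature.MathematicalPhysics.QuantumFieldTheory.Balaban1983to89.T4BetaFlowWellPosed
open Summit.QuantumFields.BalabanUV.Beta.EriceRemainderEnclosureHistoryAutonomyOrder (family_mem family_zero le_of_pin_le strictAnti_of_memFlow)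
open Summit.QuantumFields.BalabanUV.Beta.EriceRemainderEnclosureHistoryAutonomyComparisonExcess (effective_le_of_small_pin)
open Summit.QuantumFields.BalabanUV.Beta.EriceRemainderEnclosureHistoryAutonomyComparisonIsotoneExcess (family_le_of_orbit)
open Summit.QuantumFields.BalabanUV.Beta.EriceRemainderEnclosureHistoryAutonomyExistence (exists_memFlow_zm)
open Summit.QuantumFields.BalabanUV.Beta.EriceRemainderEnclosureHistoryAutonomyMonotoneGeneral (memFlow_unique_of_monotone_zm)
open Summit.QuantumFields.BalabanUV.Beta.EriceRemainderEnclosureHistoryAutonomyComparisonNonlinearRowPrep (affine_facts)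
open Summit.QuantumFields.BalabanUV.Beta.EriceRemainderEnclosureHistoryAutonomyComparisonNonlinearModulusPrep
  (excess_facts cmp_of_steps_nonneg excess_orbit_antitone)
open Summit.QuantumFields.BalabanUV.Beta.EriceRemainderEnclosureHistoryAutonomyComparisonNonlinearVariationBase (defect_size_le exists_base_depth_var var_base)
open Summit.QuantumFields.BalabanUV.Beta.EriceRemainderEnclosureHistoryAutonomyComparisonNonlinearGaugeDefect (gauge_step_of_defect)
open Summit.QuantumFields.BalabanUV.Beta.EriceRemainderEnclosureHistoryAutonomyComparisonNonlinearBaseDefect (base_gauge_of_defect)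
open Summit.QuantumFields.BalabanUV.Beta.EriceRemainderEnclosureHistoryAutonomyComparisonNonlinearSplitPrep (conf_incr_ge_split)

variable {B B₁ B' : (ℕ → ℝ) → ℝ} {γ β₀ M' ME₁ : ℝ} {L : ℕ → ℝ} {K : ℕ} {S S' : ℝ → ℕ → ℝ}

/-! ## §1 The split, the step and the base as instances -/

/-- The total excess of a split `B ≤ B₁ ≤ B′` with both parts isotone is non-negative and isotone. [folklore] -/
theorem split_facts (hexc1 : ∀ u, SeqBox γ u → B u ≤ B₁ u) (hexc2 : ∀ u, SeqBox γ u → B₁ u ≤ B' u)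
    (hDmono1 : ∀ u v : ℕ → ℝ, SeqBox γ u → SeqBox γ v → (∀ j, u j ≤ v j) → B₁ u - B u ≤ B₁ v - B v)
    (hDmono2 : ∀ u v : ℕ → ℝ, SeqBox γ u → SeqBox γ v → (∀ j, u j ≤ v j) → B' u - B₁ u ≤ B' v - B₁ v) :
    (∀ u, SeqBox γ u → B u ≤ B' u) ∧ (∀ u v : ℕ → ℝ, SeqBox γ u → SeqBox γ v → (∀ j, u j ≤ v j) → B' u - B u ≤ B' v - B v) :=
  ⟨fun u hu => (hexc1 u hu).trans (hexc2 u hu), fun u v hu hv hle => by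
    have := hDmono1 u v hu hv hle; have := hDmono2 u v hu hv hle; linarith⟩

/-- Along the base orbit both parts of the excess are non-increasing: `e₁(i+1) ≤ e₁(i)` and `e₂(i+1) ≤ e₂(i)` (pins decrease, the `B′`-family is monotone in the
pin, both parts are isotone). [folklore] -/
theorem split_orbit_antitone (hBaff : ∀ u, SeqBox γ u → B u = β₀ + ∑ k ∈ range K, L k * u k) (hL : ∀ k, 0 ≤ L k) (hβ : 0 < β₀)
    (hB' : ∀ u u' : ℕ → ℝ, SeqBox γ u → SeqBox γ u' → ∀ D : ℝ, (∀ j, |u j - u' j| ≤ D) → |B' u - B' u'| ≤ M' * D) (hM' : 0 ≤ M')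
    (hexc1 : ∀ u, SeqBox γ u → B u ≤ B₁ u) (hexc2 : ∀ u, SeqBox γ u → B₁ u ≤ B' u)
    (hDmono1 : ∀ u v : ℕ → ℝ, SeqBox γ u → SeqBox γ v → (∀ j, u j ≤ v j) → B₁ u - B u ≤ B₁ v - B v)
    (hDmono2 : ∀ u v : ℕ → ℝ, SeqBox γ u → SeqBox γ v → (∀ j, u j ≤ v j) → B' u - B₁ u ≤ B' v - B₁ v)
    (hS : ∀ p, 0 < p → p ≤ γ → SeqBox γ (S p) ∧ MemFlow B p (S p))
    (hS' : ∀ p, 0 < p → p ≤ γ → SeqBox γ (S' p) ∧ MemFlow B' p (S' p))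
    (huniq' : ∀ p, 0 < p → p ≤ γ → ∀ u u' : ℕ → ℝ, SeqBox γ u → SeqBox γ u' → MemFlow B' p u → MemFlow B' p u' → u = u')
    {y : ℝ} (hy : 0 < y) (hyγ : y ≤ γ) (i : ℕ) :
    B₁ (S' (S y (i + 1))) - B (S' (S y (i + 1))) ≤ B₁ (S' (S y i)) - B (S' (S y i))
      ∧ B' (S' (S y (i + 1))) - B₁ (S' (S y (i + 1))) ≤ B' (S' (S y i)) - B₁ (S' (S y i)) := by
  obtain ⟨hexc, hDmono⟩ := split_facts (γ := γ) hexc1 hexc2 hDmono1 hDmono2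
  obtain ⟨hmono', hlo'⟩ := excess_facts hBaff hL hβ hexc hDmono
  obtain ⟨hmono, hlo, _, _⟩ := affine_facts hBaff hL hβ
  have hq := family_mem hS hy hyγ i
  have hq1 := family_mem hS hy hyγ (i + 1)
  have hpin : S y (i + 1) ≤ S y i := (strictAnti_of_memFlow hβ hlo (hS y hy hyγ).1 (hS y hy hyγ).2).antitone (Nat.le_succ i)
  have hk0 := hS' _ hq.1 hq.2
  have hk1 := hS' _ hq1.1 hq1.2
  have hle : ∀ j, S' (S y (i + 1)) j ≤ S' (S y i) j := fun j => le_of_pin_le hβ hB' hM' hlo' huniq' hq1.1 hpin hq.2 hk1.1 hk0.1 hk1.2 hk0.2 j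
  exact ⟨hDmono1 _ _ hk1.1 hk0.1 hle, hDmono2 _ _ hk1.1 hk0.1 hle⟩

set_option maxHeartbeats 800000 in
/-- **THE STEP OF THE ROW INDUCTION FOR A SPLIT EXCESS** (`5ME₁γ + 10E₂ ≤ β₀`): if `X_m ≥ 0` and `G_{m+1} ≤ G_m` for `m ≥ n+1`, and the variation bound for the total
excess holds for `m ≥ n+2`, then `G_{n+1} + (e_n − e_{n+1})·h_n² ≤ G_n` ((E121d) `gauge_step_of_defect` with (E123a) `conf_incr_ge_split`, priced by (E121b)
`defect_size_le` at the size `ME₁γ∕2 + e₂ ≤ β₀∕10`). [folklore] -/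
theorem gauge_step_split (hBaff : ∀ u, SeqBox γ u → B u = β₀ + ∑ k ∈ range K, L k * u k) (hL : ∀ k, 0 ≤ L k) (hL0 : L 0 = 0) (hβ : 0 < β₀)
    (hB' : ∀ u u' : ℕ → ℝ, SeqBox γ u → SeqBox γ u' → ∀ D : ℝ, (∀ j, |u j - u' j| ≤ D) → |B' u - B' u'| ≤ M' * D) (hM' : 0 ≤ M')
    (hexc1 : ∀ u, SeqBox γ u → B u ≤ B₁ u) (hexc2 : ∀ u, SeqBox γ u → B₁ u ≤ B' u)
    (hDmono1 : ∀ u v : ℕ → ℝ, SeqBox γ u → SeqBox γ v → (∀ j, u j ≤ v j) → B₁ u - B u ≤ B₁ v - B v)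
    (hDmono2 : ∀ u v : ℕ → ℝ, SeqBox γ u → SeqBox γ v → (∀ j, u j ≤ v j) → B' u - B₁ u ≤ B' v - B₁ v)
    (hEmod1 : ∀ u u' : ℕ → ℝ, SeqBox γ u → SeqBox γ u' → (∀ j, u' j ≤ u j) → ∀ D : ℝ, 0 ≤ D → (∀ j, u j - u' j ≤ D) →
      (B₁ u - B u) - (B₁ u' - B u') ≤ ME₁ * D) (hME1 : 0 ≤ ME₁) {E₂ : ℝ} (hE2 : ∀ u, SeqBox γ u → B' u - B₁ u ≤ E₂) (hsplit : 5 * ME₁ * γ + 10 * E₂ ≤ β₀)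
    (hS : ∀ p, 0 < p → p ≤ γ → SeqBox γ (S p) ∧ MemFlow B p (S p))
    (huniq : ∀ p, 0 < p → p ≤ γ → ∀ u u' : ℕ → ℝ, SeqBox γ u → SeqBox γ u' → MemFlow B p u → MemFlow B p u' → u = u')
    (hS' : ∀ p, 0 < p → p ≤ γ → SeqBox γ (S' p) ∧ MemFlow B' p (S' p))
    (huniq' : ∀ p, 0 < p → p ≤ γ → ∀ u u' : ℕ → ℝ, SeqBox γ u → SeqBox γ u' → MemFlow B' p u → MemFlow B' p u' → u = u')
    {y : ℝ} (hy : 0 < y) (hyγ : y ≤ γ) (n : ℕ)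
    (hX : ∀ m, n + 1 ≤ m → 0 ≤ B' (S' (S y m)) - B (S (S y m)))
    (hg : ∀ m, n + 1 ≤ m → (B' (S' (S y (m + 1))) - B (S (S y (m + 1)))) * S y (m + 1) ^ 2 ≤ (B' (S' (S y m)) - B (S (S y m))) * S y m ^ 2)
    (hV : ∀ m, n + 2 ≤ m → ∀ J, ∑ j ∈ range J, S y (m + j) ^ 2
        * ((B' (S' (S y (m + j))) - B (S' (S y (m + j)))) - (B' (S' (S y (m + j + 1))) - B (S' (S y (m + j + 1)))))
        ≤ (B' (S' (S y m)) - B (S (S y m))) * S y m ^ 2) :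
    (B' (S' (S y (n + 1))) - B (S (S y (n + 1)))) * S y (n + 1) ^ 2
        + ((B' (S' (S y n)) - B (S' (S y n))) - (B' (S' (S y (n + 1))) - B (S' (S y (n + 1))))) * S y n ^ 2
      ≤ (B' (S' (S y n)) - B (S (S y n))) * S y n ^ 2 := by
  obtain ⟨hexc, hDmono⟩ := split_facts (γ := γ) hexc1 hexc2 hDmono1 hDmono2
  obtain ⟨hmono', hlo'⟩ := excess_facts hBaff hL hβ hexc hDmono
  obtain ⟨hmono, hlo, _, _⟩ := affine_facts hBaff hL hβ
  have hh := (hS y hy hyγ).1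
  have hf := (hS y hy hyγ).2
  have hpos : ∀ j, 0 < S y j := fun j => (hh j).1
  have hγ0 : 0 ≤ γ := hy.le.trans hyγ
  have hcmp := cmp_of_steps_nonneg hBaff hL hβ hB' hM' hexc hDmono hS huniq hS' huniq' hy hyγ n hX
  set e : ℕ → ℝ := fun i => B' (S' (S y i)) - B₁ (S' (S y i)) with he_def
  have he0 : ∀ i, 0 ≤ e i := fun i => by simp only [he_def]; linarith [hexc2 _ (hS' _ (family_mem hS hy hyγ i).1 (family_mem hS hy hyγ i).2).1]
  have heE : ∀ i, e i ≤ E₂ := fun i => hE2 _ (hS' _ (family_mem hS hy hyγ i).1 (family_mem hS hy hyγ i).2).1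
  -- the variation bound for e₂ from the one for the total excess (Δe₁ ≥ 0 along the orbit)
  have hV2 : ∀ m, n + 2 ≤ m → ∀ J, ∑ j ∈ range J, S y (m + j) ^ 2 * (e (m + j) - e (m + j + 1)) ≤ (B' (S' (S y m)) - B (S (S y m))) * S y m ^ 2 := by
    intro m hm J
    refine le_trans (sum_le_sum fun j _ => ?_) (hV m hm J)
    have h1 := split_orbit_antitone hBaff hL hβ hB' hM' hexc1 hexc2 hDmono1 hDmono2 hS hS' huniq' hy hyγ (m + j)
    simp only [he_def]
    exact mul_le_mul_of_nonneg_left (by linarith) (sq_nonneg _)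
  -- the defect data
  set ξ : ℕ → ℝ := fun k => ME₁ * S y (n + k + 1) ^ 3 / 2 + e (n + k + 1) * S y (n + k + 1) ^ 2 with hξ_def
  set θ : ℕ → ℝ := fun k => ∑ q ∈ Ico 1 K, L q * S y (n + k + 1 + q) ^ 3 / 2 + ξ k with hθ_def
  have hθ0 : ∀ k, 0 ≤ θ k := fun k => by
    have h1 : 0 ≤ ∑ q ∈ Ico 1 K, L q * S y (n + k + 1 + q) ^ 3 / 2 :=
      sum_nonneg fun q _ => by have := hL q; have := hpos (n + k + 1 + q); positivity
    have h2 : 0 ≤ ξ k := by have := he0 (n + k + 1); have := hpos (n + k + 1); positivity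
    simp only [hθ_def]; linarith
  have hdef : ∀ j, j + 1 < K → (1 / S' (S y (n + 1)) j ^ 2 - 1 / S y (n + 1 + j) ^ 2)
      - (1 / S' (S y (n + 1)) (j + 1) ^ 2 - 1 / S y (n + 1 + j + 1) ^ 2)
      ≤ θ (j + 1) * (1 / S' (S y (n + 1)) j ^ 2 - 1 / S y (n + 1 + j) ^ 2) := by
    intro j _
    have h := conf_incr_ge_split hBaff hL hL0 hβ hB' hM' hexc1 hexc2 hDmono1 hDmono2 hEmod1 hME1 hS huniq hS' huniq' hy hyγ (n + 1) j
      (hcmp (n + 1) (by omega)) (hcmp (n + 1 + 1 + j) (by omega)) (hV2 (n + 1 + 1 + j) (by omega))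
    rw [show n + 1 + 1 + j = n + (j + 1) + 1 by ring] at h
    have e3 : ∑ q ∈ Ico 1 K, L q * S y (n + (j + 1) + 1 + q) ^ 3 / 2 + ME₁ * S y (n + (j + 1) + 1) ^ 3 / 2
        + e (n + (j + 1) + 1) * S y (n + (j + 1) + 1) ^ 2 = θ (j + 1) := by simp only [hθ_def, hξ_def, he_def]; ring
    rw [e3] at h
    exact h
  have hθle : ∀ k, 2 ≤ k → k < K → θ k ≤ ∑ q ∈ Ico 1 K, L q * S y (n + k + 1 + q) ^ 3 / 2 + ξ k := fun k _ _ => le_rfl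
  have hprice : ∀ k, 2 ≤ k → k < K → ∀ W : ℝ, 0 ≤ W →
      W ≤ (B' (S' (S y (n + 1))) - B (S (S y (n + 1)))) * S y (n + 1) ^ 2 * ∑ l ∈ Ico 1 k, 1 / S y (n + 1 + l) ^ 2 →
      L k * S y (n + 1 + k) ^ 3 / 2 * ξ k * W ≤ 1 / 20 * (L k * S y (n + 1 + k) * S y (n + 1) ^ 2 * (B' (S' (S y (n + 1))) - B (S (S y (n + 1))))) := by
    intro k hk2 _ W hW0 hW
    -- ξ_k ≤ (ME₁γ∕2 + e)·h², and ME₁γ∕2 + e ≤ β₀∕10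
    have hx := hpos (n + k + 1)
    have hξle : ξ k ≤ (ME₁ * γ / 2 + e (n + k + 1)) * S y (n + k + 1) ^ 2 := by
      have h3 : S y (n + k + 1) ^ 3 ≤ γ * S y (n + k + 1) ^ 2 := by nlinarith [pow_pos hx 2, (hh (n + k + 1)).2]
      have := mul_le_mul_of_nonneg_left h3 hME1
      simp only [hξ_def]; nlinarith
    have he' : ME₁ * γ / 2 + e (n + k + 1) ≤ β₀ / 10 := by have := heE (n + k + 1); nlinarith
    have he'0 : 0 ≤ ME₁ * γ / 2 + e (n + k + 1) := by have := he0 (n + k + 1); positivity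
    have hc0 : 0 ≤ L k * S y (n + 1 + k) ^ 3 / 2 := by have := hL k; have := hpos (n + 1 + k); positivity
    have h1 := defect_size_le (B := B) (L := L) hL hβ hlo hh hf he'0 he' n (by omega) (hX (n + 1) le_rfl) hW
    calc L k * S y (n + 1 + k) ^ 3 / 2 * ξ k * W ≤ L k * S y (n + 1 + k) ^ 3 / 2 * ((ME₁ * γ / 2 + e (n + k + 1)) * S y (n + k + 1) ^ 2) * W :=
          mul_le_mul_of_nonneg_right (mul_le_mul_of_nonneg_left hξle hc0) hW0
      _ ≤ _ := h1
  exact gauge_step_of_defect hBaff hL hβ hB' hM' hexc hDmono hS huniq hS' huniq' hy hyγ n hX hg hθ0 hdef hθle hprice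


set_option maxHeartbeats 800000 in
/-- **THE BASE OF THE ROW INDUCTION FOR A SPLIT EXCESS**: in the deep region (`u_n ≤ 1∕(5(K+1))`), with configurations comparing from every pin `h_m`, `m ≥ n`, and
`X_m ≥ 0` for `m ≥ n+1`, `G_{n+1} + (e_n − e_{n+1})·h_n² ≤ G_n` ((E122a) `base_gauge_of_defect` with (E123a) `conf_incr_ge_split`; the extra `ME₁h³∕2 + e₂h² ≤ (β₀∕10)·h_{n+1}²`;
the variation bound for `e₂` in the deep region from (E121b) `var_base` for the total excess). [folklore] -/
theorem base_gauge_split (hBaff : ∀ u, SeqBox γ u → B u = β₀ + ∑ k ∈ range K, L k * u k) (hL : ∀ k, 0 ≤ L k) (hL0 : L 0 = 0) (hβ : 0 < β₀)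
    (hB' : ∀ u u' : ℕ → ℝ, SeqBox γ u → SeqBox γ u' → ∀ D : ℝ, (∀ j, |u j - u' j| ≤ D) → |B' u - B' u'| ≤ M' * D) (hM' : 0 ≤ M')
    (hexc1 : ∀ u, SeqBox γ u → B u ≤ B₁ u) (hexc2 : ∀ u, SeqBox γ u → B₁ u ≤ B' u)
    (hDmono1 : ∀ u v : ℕ → ℝ, SeqBox γ u → SeqBox γ v → (∀ j, u j ≤ v j) → B₁ u - B u ≤ B₁ v - B v)
    (hDmono2 : ∀ u v : ℕ → ℝ, SeqBox γ u → SeqBox γ v → (∀ j, u j ≤ v j) → B' u - B₁ u ≤ B' v - B₁ v)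
    (hEmod1 : ∀ u u' : ℕ → ℝ, SeqBox γ u → SeqBox γ u' → (∀ j, u' j ≤ u j) → ∀ D : ℝ, 0 ≤ D → (∀ j, u j - u' j ≤ D) →
      (B₁ u - B u) - (B₁ u' - B u') ≤ ME₁ * D) (hME1 : 0 ≤ ME₁) {E₂ : ℝ} (hE2 : ∀ u, SeqBox γ u → B' u - B₁ u ≤ E₂) (hsplit : 5 * ME₁ * γ + 10 * E₂ ≤ β₀)
    (hS : ∀ p, 0 < p → p ≤ γ → SeqBox γ (S p) ∧ MemFlow B p (S p))
    (huniq : ∀ p, 0 < p → p ≤ γ → ∀ u u' : ℕ → ℝ, SeqBox γ u → SeqBox γ u' → MemFlow B p u → MemFlow B p u' → u = u')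
    (hS' : ∀ p, 0 < p → p ≤ γ → SeqBox γ (S' p) ∧ MemFlow B' p (S' p))
    (huniq' : ∀ p, 0 < p → p ≤ γ → ∀ u u' : ℕ → ℝ, SeqBox γ u → SeqBox γ u' → MemFlow B' p u → MemFlow B' p u' → u = u')
    {y : ℝ} (hy : 0 < y) (hyγ : y ≤ γ) (n : ℕ)
    (hu : (1 / S y (n + 1) ^ 2 - 1 / S y n ^ 2) * S y (n + 1) ^ 2 ≤ 1 / (5 * ((K : ℝ) + 1)))
    (hcmp : ∀ m, n ≤ m → ∀ j, S' (S y m) j ≤ S y (m + j)) (hX : ∀ m, n + 1 ≤ m → 0 ≤ B' (S' (S y m)) - B (S (S y m)))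
    (hV : ∀ m, n + 2 ≤ m → ∀ J, ∑ j ∈ range J, S y (m + j) ^ 2
        * ((B' (S' (S y (m + j))) - B (S' (S y (m + j)))) - (B' (S' (S y (m + j + 1))) - B (S' (S y (m + j + 1)))))
        ≤ (B' (S' (S y m)) - B (S (S y m))) * S y m ^ 2) :
    (B' (S' (S y (n + 1))) - B (S (S y (n + 1)))) * S y (n + 1) ^ 2
        + ((B' (S' (S y n)) - B (S' (S y n))) - (B' (S' (S y (n + 1))) - B (S' (S y (n + 1))))) * S y n ^ 2
      ≤ (B' (S' (S y n)) - B (S (S y n))) * S y n ^ 2 := by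
  obtain ⟨hexc, hDmono⟩ := split_facts (γ := γ) hexc1 hexc2 hDmono1 hDmono2
  obtain ⟨hmono', hlo'⟩ := excess_facts hBaff hL hβ hexc hDmono
  obtain ⟨hmono, hlo, _, _⟩ := affine_facts hBaff hL hβ
  have hh := (hS y hy hyγ).1
  have hpos : ∀ j, 0 < S y j := fun j => (hh j).1
  have hanti := (strictAnti_of_memFlow hβ hlo hh (hS y hy hyγ).2).antitone
  set e : ℕ → ℝ := fun i => B' (S' (S y i)) - B₁ (S' (S y i)) with he_def
  have he0 : ∀ i, 0 ≤ e i := fun i => by simp only [he_def]; linarith [hexc2 _ (hS' _ (family_mem hS hy hyγ i).1 (family_mem hS hy hyγ i).2).1]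
  have heE : ∀ i, e i ≤ E₂ := fun i => hE2 _ (hS' _ (family_mem hS hy hyγ i).1 (family_mem hS hy hyγ i).2).1
  have hV2 : ∀ m, n + 2 ≤ m → ∀ J, ∑ j ∈ range J, S y (m + j) ^ 2 * (e (m + j) - e (m + j + 1)) ≤ (B' (S' (S y m)) - B (S (S y m))) * S y m ^ 2 := by
    intro m hm J
    refine le_trans (sum_le_sum fun j _ => ?_) (hV m hm J)
    have h1 := split_orbit_antitone hBaff hL hβ hB' hM' hexc1 hexc2 hDmono1 hDmono2 hS hS' huniq' hy hyγ (m + j)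
    simp only [he_def]
    exact mul_le_mul_of_nonneg_left (by linarith) (sq_nonneg _)
  set ξ : ℕ → ℝ := fun k => ME₁ * S y (n + k + 1) ^ 3 / 2 + e (n + k + 1) * S y (n + k + 1) ^ 2 with hξ_def
  set θ : ℕ → ℝ := fun k => ∑ q ∈ Ico 1 K, L q * S y (n + k + 1 + q) ^ 3 / 2 + ξ k with hθ_def
  have hξ0 : ∀ k, 0 ≤ ξ k := fun k => by have := he0 (n + k + 1); have := hpos (n + k + 1); positivity
  have hθ0 : ∀ k, 0 ≤ θ k := fun k => by
    have h1 : 0 ≤ ∑ q ∈ Ico 1 K, L q * S y (n + k + 1 + q) ^ 3 / 2 :=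
      sum_nonneg fun q _ => by have := hL q; have := hpos (n + k + 1 + q); positivity
    have h2 := hξ0 k
    simp only [hθ_def]; linarith
  have hdef : ∀ j, j + 1 < K → (1 / S' (S y (n + 1)) j ^ 2 - 1 / S y (n + 1 + j) ^ 2)
      - (1 / S' (S y (n + 1)) (j + 1) ^ 2 - 1 / S y (n + 1 + j + 1) ^ 2)
      ≤ θ (j + 1) * (1 / S' (S y (n + 1)) j ^ 2 - 1 / S y (n + 1 + j) ^ 2) := by
    intro j _
    have h := conf_incr_ge_split hBaff hL hL0 hβ hB' hM' hexc1 hexc2 hDmono1 hDmono2 hEmod1 hME1 hS huniq hS' huniq' hy hyγ (n + 1) j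
      (hcmp (n + 1) (by omega)) (hcmp (n + 1 + 1 + j) (by omega)) (hV2 (n + 1 + 1 + j) (by omega))
    rw [show n + 1 + 1 + j = n + (j + 1) + 1 by ring] at h
    have e3 : ∑ q ∈ Ico 1 K, L q * S y (n + (j + 1) + 1 + q) ^ 3 / 2 + ME₁ * S y (n + (j + 1) + 1) ^ 3 / 2
        + e (n + (j + 1) + 1) * S y (n + (j + 1) + 1) ^ 2 = θ (j + 1) := by simp only [hθ_def, hξ_def, he_def]; ring
    rw [e3] at h
    exact h
  have hθle : ∀ k, 1 ≤ k → k < K → θ k ≤ ∑ q ∈ Ico 1 K, L q * S y (n + k + 1 + q) ^ 3 / 2 + ξ k := fun k _ _ => le_rfl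
  have hξ : ∀ k, 1 ≤ k → k < K → ξ k ≤ β₀ / 10 * S y (n + 1) ^ 2 := by
    intro k hk1 _
    have hx := hpos (n + k + 1)
    have h2k : S y (n + k + 1) ^ 2 ≤ S y (n + 1) ^ 2 := pow_le_pow_left₀ hx.le (hanti (by omega)) 2
    have h3 : S y (n + k + 1) ^ 3 ≤ γ * S y (n + k + 1) ^ 2 := by nlinarith [pow_pos hx 2, (hh (n + k + 1)).2]
    have h4 := mul_le_mul_of_nonneg_left h3 hME1
    have h5 : (ME₁ * γ / 2 + e (n + k + 1)) * S y (n + k + 1) ^ 2 ≤ β₀ / 10 * S y (n + 1) ^ 2 := by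
      have he' : ME₁ * γ / 2 + e (n + k + 1) ≤ β₀ / 10 := by have := heE (n + k + 1); nlinarith
      have he'0 : 0 ≤ ME₁ * γ / 2 + e (n + k + 1) := by have := he0 (n + k + 1); have : 0 ≤ γ := hy.le.trans hyγ; positivity
      exact mul_le_mul he' h2k (sq_nonneg _) (by positivity)
    simp only [hξ_def]; nlinarith
  exact base_gauge_of_defect hBaff hL hβ hB' hM' hexc hDmono hS huniq hS' huniq' hy hyγ n hu hcmp hX hθ0 hξ0 hdef hθle hξ

/-! ## §2 The nonlinear level gauge and the variation bound along every orbit -/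

/-- **THE NONLINEAR LEVEL GAUGE FOR A SPLIT EXCESS.**  Base affine (any profile, range, size; `L_0 = 0`); `B ≤ B₁ ≤ B′`, `B₁ − B` isotone of modulus `ME₁`, `B′ − B₁`
isotone and `≤ E₂`, `5ME₁γ + 10E₂ ≤ β₀`; `B′` with modulus `M′`; unique solution families.  Along the base orbit `h = S y`: at EVERY depth `m`, `X_m ≥ 0`, `X_{m+1}h_{m+1}² ≤ X_mh_m²`, and
`Σ_{j<J} h_{m+j}²·(e_{m+j} − e_{m+j+1}) ≤ X_mh_m²` for every `J` (row induction from the deep region of (E121b) `exists_base_depth_var`). [folklore] -/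
theorem steps_nonneg_gauge_split (hBaff : ∀ u, SeqBox γ u → B u = β₀ + ∑ k ∈ range K, L k * u k) (hL : ∀ k, 0 ≤ L k) (hL0 : L 0 = 0) (hβ : 0 < β₀)
    (hB' : ∀ u u' : ℕ → ℝ, SeqBox γ u → SeqBox γ u' → ∀ D : ℝ, (∀ j, |u j - u' j| ≤ D) → |B' u - B' u'| ≤ M' * D) (hM' : 0 ≤ M')
    (hexc1 : ∀ u, SeqBox γ u → B u ≤ B₁ u) (hexc2 : ∀ u, SeqBox γ u → B₁ u ≤ B' u)
    (hDmono1 : ∀ u v : ℕ → ℝ, SeqBox γ u → SeqBox γ v → (∀ j, u j ≤ v j) → B₁ u - B u ≤ B₁ v - B v)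
    (hDmono2 : ∀ u v : ℕ → ℝ, SeqBox γ u → SeqBox γ v → (∀ j, u j ≤ v j) → B' u - B₁ u ≤ B' v - B₁ v)
    (hEmod1 : ∀ u u' : ℕ → ℝ, SeqBox γ u → SeqBox γ u' → (∀ j, u' j ≤ u j) → ∀ D : ℝ, 0 ≤ D → (∀ j, u j - u' j ≤ D) →
      (B₁ u - B u) - (B₁ u' - B u') ≤ ME₁ * D) (hME1 : 0 ≤ ME₁) {E₂ : ℝ} (hE2 : ∀ u, SeqBox γ u → B' u - B₁ u ≤ E₂) (hsplit : 5 * ME₁ * γ + 10 * E₂ ≤ β₀)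
    (hS : ∀ p, 0 < p → p ≤ γ → SeqBox γ (S p) ∧ MemFlow B p (S p))
    (huniq : ∀ p, 0 < p → p ≤ γ → ∀ u u' : ℕ → ℝ, SeqBox γ u → SeqBox γ u' → MemFlow B p u → MemFlow B p u' → u = u')
    (hS' : ∀ p, 0 < p → p ≤ γ → SeqBox γ (S' p) ∧ MemFlow B' p (S' p))
    (huniq' : ∀ p, 0 < p → p ≤ γ → ∀ u u' : ℕ → ℝ, SeqBox γ u → SeqBox γ u' → MemFlow B' p u → MemFlow B' p u' → u = u')
    {y : ℝ} (hy : 0 < y) (hyγ : y ≤ γ) :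
    ∀ m, 0 ≤ B' (S' (S y m)) - B (S (S y m))
      ∧ (B' (S' (S y (m + 1))) - B (S (S y (m + 1)))) * S y (m + 1) ^ 2 ≤ (B' (S' (S y m)) - B (S (S y m))) * S y m ^ 2
      ∧ ∀ J, ∑ j ∈ range J, S y (m + j) ^ 2
          * ((B' (S' (S y (m + j))) - B (S' (S y (m + j)))) - (B' (S' (S y (m + j + 1))) - B (S' (S y (m + j + 1)))))
        ≤ (B' (S' (S y m)) - B (S (S y m))) * S y m ^ 2 := by
  obtain ⟨hexc, hDmono⟩ := split_facts (γ := γ) hexc1 hexc2 hDmono1 hDmono2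
  obtain ⟨hmono, hlo, hdom, hBmod⟩ := affine_facts hBaff hL hβ
  have hM : 0 ≤ ∑ k ∈ range K, L k := sum_nonneg fun k _ => hL k
  have hh := (hS y hy hyγ).1
  have hf := (hS y hy hyγ).2
  have hpos : ∀ j, 0 < S y j := fun j => (hh j).1
  -- the deep region
  obtain ⟨N₀, hN₀⟩ := exists_base_depth_var hBaff hL hβ hh hf
  have hXdeep : ∀ m, N₀ ≤ m → 0 ≤ B' (S' (S y m)) - B (S (S y m)) := by
    intro m hm
    have hq := family_mem hS hy hyγ m
    have hsmall := (hN₀ m hm).1.2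
    have := effective_le_of_small_pin hBmod hM hβ hlo hexc hDmono hq.1 hq.2 hsmall (hS _ hq.1 hq.2).1 (hS _ hq.1 hq.2).2
      (hS' _ hq.1 hq.2).1 (hS' _ hq.1 hq.2).2
    linarith
  -- P(n): non-negativity, the gauge and the variation bound at every m ≥ n
  have hP : ∀ d n, N₀ ≤ n + d → ∀ m, n ≤ m → 0 ≤ B' (S' (S y m)) - B (S (S y m))
      ∧ (B' (S' (S y (m + 1))) - B (S (S y (m + 1)))) * S y (m + 1) ^ 2 ≤ (B' (S' (S y m)) - B (S (S y m))) * S y m ^ 2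
      ∧ ∀ J, ∑ j ∈ range J, S y (m + j) ^ 2
          * ((B' (S' (S y (m + j))) - B (S' (S y (m + j)))) - (B' (S' (S y (m + j + 1))) - B (S' (S y (m + j + 1)))))
        ≤ (B' (S' (S y m)) - B (S (S y m))) * S y m ^ 2 := by
    intro d
    induction d with
    | zero =>
      intro n hn m hm
      rw [add_zero] at hn
      have hcmp := cmp_of_steps_nonneg hBaff hL hβ hB' hM' hexc hDmono hS huniq hS' huniq' hy hyγ m fun m' hm' => hXdeep m' (by omega)
      refine ⟨hXdeep m (hn.trans hm), ?_, ?_⟩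
      · have hb := base_gauge_split hBaff hL hL0 hβ hB' hM' hexc1 hexc2 hDmono1 hDmono2 hEmod1 hME1 hE2 hsplit hS huniq hS' huniq' hy hyγ m
          (hN₀ m (hn.trans hm)).1.1 hcmp (fun m' hm' => hXdeep m' (by omega)) fun m' hm' => var_base hBaff hL hβ hB' hM' hexc hDmono hS huniq hS' huniq' hy hyγ m'
            (hN₀ m' (by omega)).2 fun m'' hm'' => hcmp m'' (by omega)
        have hΔ := (excess_orbit_antitone hBaff hL hβ hB' hM' hexc hDmono hS hS' huniq' hy hyγ m).2
        nlinarith [sq_nonneg (S y m)]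
      · exact var_base hBaff hL hβ hB' hM' hexc hDmono hS huniq hS' huniq' hy hyγ m (hN₀ m (hn.trans hm)).2 hcmp
    | succ d ih =>
      intro n hn m hm
      have ih' := ih (n + 1) (by omega)
      by_cases hm1 : n + 1 ≤ m
      · exact ih' m hm1
      · have hmn : m = n := by omega
        subst hmn
        have hXb : ∀ m', m + 1 ≤ m' → 0 ≤ B' (S' (S y m')) - B (S (S y m')) := fun m' hm' => (ih' m' hm').1
        have hgb : ∀ m', m + 1 ≤ m' → (B' (S' (S y (m' + 1))) - B (S (S y (m' + 1)))) * S y (m' + 1) ^ 2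
            ≤ (B' (S' (S y m')) - B (S (S y m'))) * S y m' ^ 2 := fun m' hm' => (ih' m' hm').2.1
        have hVb : ∀ m', m + 2 ≤ m' → ∀ J, ∑ j ∈ range J, S y (m' + j) ^ 2
            * ((B' (S' (S y (m' + j))) - B (S' (S y (m' + j)))) - (B' (S' (S y (m' + j + 1))) - B (S' (S y (m' + j + 1)))))
            ≤ (B' (S' (S y m')) - B (S (S y m'))) * S y m' ^ 2 := fun m' hm' => (ih' m' (by omega)).2.2
        have hgs := gauge_step_split hBaff hL hL0 hβ hB' hM' hexc1 hexc2 hDmono1 hDmono2 hEmod1 hME1 hE2 hsplit hS huniq hS' huniq' hy hyγ m hXb hgb hVb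
        have hΔe := (excess_orbit_antitone hBaff hL hβ hB' hM' hexc hDmono hS hS' huniq' hy hyγ m).2
        have hm2 : 0 < S y m ^ 2 := pow_pos (hpos m) 2
        have hΔe' : 0 ≤ ((B' (S' (S y m)) - B (S' (S y m))) - (B' (S' (S y (m + 1))) - B (S' (S y (m + 1))))) * S y m ^ 2 :=
          mul_nonneg (by linarith) hm2.le
        have hG1 : 0 ≤ (B' (S' (S y (m + 1))) - B (S (S y (m + 1)))) * S y (m + 1) ^ 2 := mul_nonneg (hXb (m + 1) le_rfl) (sq_nonneg _)
        refine ⟨?_, by linarith, ?_⟩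
        · have h1 : 0 ≤ (B' (S' (S y m)) - B (S (S y m))) * S y m ^ 2 := by linarith
          nlinarith
        · intro J
          cases J with
          | zero => simp only [range_zero, sum_empty]; linarith
          | succ J' =>
            rw [sum_range_succ']
            simp only [add_zero]
            have hrest := (ih' (m + 1) le_rfl).2.2 J'
            have e : ∑ j ∈ range J', S y (m + (j + 1)) ^ 2
                * ((B' (S' (S y (m + (j + 1)))) - B (S' (S y (m + (j + 1))))) - (B' (S' (S y (m + (j + 1) + 1))) - B (S' (S y (m + (j + 1) + 1)))))
                = ∑ j ∈ range J', S y (m + 1 + j) ^ 2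
                * ((B' (S' (S y (m + 1 + j))) - B (S' (S y (m + 1 + j)))) - (B' (S' (S y (m + 1 + j + 1))) - B (S' (S y (m + 1 + j + 1))))) :=
              sum_congr rfl fun j _ => by rw [show m + (j + 1) = m + 1 + j by ring]
            rw [e]
            linarith
  intro m
  exact hP N₀ 0 (by omega) m (Nat.zero_le m)

/-! ## §3 Comparison at any steepness for an isotone excess of small size -/

/-- **THE EFFECTIVE β-FUNCTIONS OF `B` AND `B′` ARE ORDERED AT EVERY PIN**, `B(S y) ≤ B′(S′y)` for every `y ∈ ]0,γ]` — affine base of any profile and size, split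
excess `E₁ + E₂` (smooth + small) with `5ME₁γ + 10E₂ ≤ β₀`. [folklore] -/
theorem effective_le_split (hBaff : ∀ u, SeqBox γ u → B u = β₀ + ∑ k ∈ range K, L k * u k) (hL : ∀ k, 0 ≤ L k) (hL0 : L 0 = 0) (hβ : 0 < β₀)
    (hB' : ∀ u u' : ℕ → ℝ, SeqBox γ u → SeqBox γ u' → ∀ D : ℝ, (∀ j, |u j - u' j| ≤ D) → |B' u - B' u'| ≤ M' * D) (hM' : 0 ≤ M')
    (hexc1 : ∀ u, SeqBox γ u → B u ≤ B₁ u) (hexc2 : ∀ u, SeqBox γ u → B₁ u ≤ B' u)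
    (hDmono1 : ∀ u v : ℕ → ℝ, SeqBox γ u → SeqBox γ v → (∀ j, u j ≤ v j) → B₁ u - B u ≤ B₁ v - B v)
    (hDmono2 : ∀ u v : ℕ → ℝ, SeqBox γ u → SeqBox γ v → (∀ j, u j ≤ v j) → B' u - B₁ u ≤ B' v - B₁ v)
    (hEmod1 : ∀ u u' : ℕ → ℝ, SeqBox γ u → SeqBox γ u' → (∀ j, u' j ≤ u j) → ∀ D : ℝ, 0 ≤ D → (∀ j, u j - u' j ≤ D) →
      (B₁ u - B u) - (B₁ u' - B u') ≤ ME₁ * D) (hME1 : 0 ≤ ME₁) {E₂ : ℝ} (hE2 : ∀ u, SeqBox γ u → B' u - B₁ u ≤ E₂) (hsplit : 5 * ME₁ * γ + 10 * E₂ ≤ β₀)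
    (hS : ∀ p, 0 < p → p ≤ γ → SeqBox γ (S p) ∧ MemFlow B p (S p))
    (huniq : ∀ p, 0 < p → p ≤ γ → ∀ u u' : ℕ → ℝ, SeqBox γ u → SeqBox γ u' → MemFlow B p u → MemFlow B p u' → u = u')
    (hS' : ∀ p, 0 < p → p ≤ γ → SeqBox γ (S' p) ∧ MemFlow B' p (S' p))
    (huniq' : ∀ p, 0 < p → p ≤ γ → ∀ u u' : ℕ → ℝ, SeqBox γ u → SeqBox γ u' → MemFlow B' p u → MemFlow B' p u' → u = u') :
    ∀ y, 0 < y → y ≤ γ → B (S y) ≤ B' (S' y) := by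
  intro y hy hyγ
  have := (steps_nonneg_gauge_split hBaff hL hL0 hβ hB' hM' hexc1 hexc2 hDmono1 hDmono2 hEmod1 hME1 hE2 hsplit hS huniq hS' huniq' hy hyγ 0).1
  rw [family_zero hS hy hyγ] at this
  linarith

/-- **COMPARISON FOR EVERY SPLIT EXCESS `E = E₁ + E₂` (SMOOTH + SMALL), family-free form.**  `B u = β₀ + Σ_{k<K} L_k·u_k` on the box ]0,γ] with `β₀ > 0`, `L ≥ 0`,
`L_0 = 0` — profile, range `K`, ALL SIZES ARBITRARY (no light-row condition); functionals `B ≤ B₁ ≤ B′` on the box, `B₁ − B` ISOTONE of modulus `ME₁` along ordered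
pairs, `B′ − B₁` ISOTONE and `≤ E₂` (no modulus), with **`5·ME₁·γ + 10·E₂ ≤ β₀`**; `B′` with a modulus `M′ ≥ 0`; `h`, `h′` ANY box solutions of `B`, `B′` from one pin
`p ∈ ]0,γ]`.  Then `h′ ≤ h` at EVERY scale — (E119d) `le_of_small_modulus_excess` is `E₂ = 0` (up to the constant), (E121e) `le_of_small_isotone_excess` is `E₁ = 0`. [folklore] -/
theorem le_of_split_excess {p : ℝ} {h h' : ℕ → ℝ} (hBaff : ∀ u, SeqBox γ u → B u = β₀ + ∑ k ∈ range K, L k * u k) (hL : ∀ k, 0 ≤ L k)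
    (hL0 : L 0 = 0) (hβ : 0 < β₀)
    (hB' : ∀ u u' : ℕ → ℝ, SeqBox γ u → SeqBox γ u' → ∀ D : ℝ, (∀ j, |u j - u' j| ≤ D) → |B' u - B' u'| ≤ M' * D) (hM' : 0 ≤ M')
    (hexc1 : ∀ u, SeqBox γ u → B u ≤ B₁ u) (hexc2 : ∀ u, SeqBox γ u → B₁ u ≤ B' u)
    (hDmono1 : ∀ u v : ℕ → ℝ, SeqBox γ u → SeqBox γ v → (∀ j, u j ≤ v j) → B₁ u - B u ≤ B₁ v - B v)
    (hDmono2 : ∀ u v : ℕ → ℝ, SeqBox γ u → SeqBox γ v → (∀ j, u j ≤ v j) → B' u - B₁ u ≤ B' v - B₁ v)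
    (hEmod1 : ∀ u u' : ℕ → ℝ, SeqBox γ u → SeqBox γ u' → (∀ j, u' j ≤ u j) → ∀ D : ℝ, 0 ≤ D → (∀ j, u j - u' j ≤ D) →
      (B₁ u - B u) - (B₁ u' - B u') ≤ ME₁ * D) (hME1 : 0 ≤ ME₁) {E₂ : ℝ} (hE2 : ∀ u, SeqBox γ u → B' u - B₁ u ≤ E₂) (hsplit : 5 * ME₁ * γ + 10 * E₂ ≤ β₀)
    (hp : 0 < p) (hpγ : p ≤ γ) (hh : SeqBox γ h) (hf : MemFlow B p h) (hh' : SeqBox γ h') (hf' : MemFlow B' p h') (j : ℕ) :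
    h' j ≤ h j := by
  obtain ⟨hexc, hDmono⟩ := split_facts (γ := γ) hexc1 hexc2 hDmono1 hDmono2
  obtain ⟨hmono', hlo'⟩ := excess_facts hBaff hL hβ hexc hDmono
  obtain ⟨hmono, hlo, _, hBmod⟩ := affine_facts hBaff hL hβ
  have hM : 0 ≤ ∑ k ∈ range K, L k := sum_nonneg fun k _ => hL k
  have hγ : 0 < γ := hp.trans_le hpγ
  have hex : ∀ q : ℝ, 0 < q → q ≤ γ → ∃ k : ℕ → ℝ, SeqBox γ k ∧ MemFlow B q k := fun q hq hqγ => exists_memFlow_zm hBmod hM hq hqγ hβ hlo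
  have hex' : ∀ q : ℝ, 0 < q → q ≤ γ → ∃ k : ℕ → ℝ, SeqBox γ k ∧ MemFlow B' q k := fun q hq hqγ => exists_memFlow_zm hB' hM' hq hqγ hβ hlo'
  choose! S hSb hSf using hex
  choose! S' hS'b hS'f using hex'
  have hS : ∀ q, 0 < q → q ≤ γ → SeqBox γ (S q) ∧ MemFlow B q (S q) := fun q hq hqγ => ⟨hSb q hq hqγ, hSf q hq hqγ⟩
  have hS' : ∀ q, 0 < q → q ≤ γ → SeqBox γ (S' q) ∧ MemFlow B' q (S' q) := fun q hq hqγ => ⟨hS'b q hq hqγ, hS'f q hq hqγ⟩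
  have huniq : ∀ q, 0 < q → q ≤ γ → ∀ u u' : ℕ → ℝ, SeqBox γ u → SeqBox γ u' → MemFlow B q u → MemFlow B q u' → u = u' :=
    fun q hq _ u u' hu hu' hfu hfu' => memFlow_unique_of_monotone_zm hmono hBmod hM hq hβ hlo hu hu' hfu hfu'
  have huniq' : ∀ q, 0 < q → q ≤ γ → ∀ u u' : ℕ → ℝ, SeqBox γ u → SeqBox γ u' → MemFlow B' q u → MemFlow B' q u' → u = u' :=
    fun q hq _ u u' hu hu' hfu hfu' => memFlow_unique_of_monotone_zm hmono' hB' hM' hq hβ hlo' hu hu' hfu hfu'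
  have e : h = S p := huniq p hp hpγ _ _ hh (hS p hp hpγ).1 hf (hS p hp hpγ).2
  have e' : h' = S' p := huniq' p hp hpγ _ _ hh' (hS' p hp hpγ).1 hf' (hS' p hp hpγ).2
  rw [e, e']
  exact family_le_of_orbit hβ hγ hB' hM' hlo' hS huniq hS' huniq' ⟨hp, hpγ⟩ (fun i _ =>
    effective_le_split hBaff hL hL0 hβ hB' hM' hexc1 hexc2 hDmono1 hDmono2 hEmod1 hME1 hE2 hsplit hS huniq hS' huniq' _
      (family_mem hS hp hpγ i).1 (family_mem hS hp hpγ i).2) j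

end Summit.QuantumFields.BalabanUV.Beta.EriceRemainderEnclosureHistoryAutonomyComparisonNonlinearSplit

end
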